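import Summits.CriticalPhenomena.PercolationContinuityZ3.Theorems.PercNearOneGluingNoHeavyLowerTailSahiAllButTwo
import Summits.CriticalPhenomena.PercolationContinuityZ3.Theorems.PercNearOneGluingNoHeavyLowerTailSahiCTCNcGen

/-!
# `NoHeavyLowerTail` (crux stmt-CriticalPhenomena-4575), Sahi / Kahn positivity: the level-`c` THRESHOLD CERTIFICATE for every `c` —
# `ρ_c = μ(· | exactly c closed)` is a reduced transport certificate of `Th_{k−c}^k` as soon as (a) holds and `Ñ_c ≥ 0` at the odds vector

Support file (cell `prim-l12`, seat P3, gen 21; `--supports stmt-CriticalPhenomena-4575`).  No `sorry`, no named facts, standard axioms.  Memo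
`run/shared/lean/prim/prim-l12/FROM-prim-l12-p3-g21-*.md`.  This is `…SahiAllButTwo` (the case `c = 2`) written uniformly in the threshold
level `c`, on top of the generic certificate polynomial `Ngen c` of `…SahiCTCNcGen`.

**THEOREM `rhoCert_allBut`.**  Let `c ≤ k` and `q` interior.  If (a) `Θ_c(r)·D_c(r) ≤ (Π(r)+D_c(r))·e_c(r)` and (TC) `Ñ_c(K_𝒳, K_𝒵)(r) ≥ 0` for
all nonempty up-sets `𝒳, 𝒵` of patterns (`K_𝒴` the closed-set complex), then `ρ_c = μ(· | exactly c closed)` is a reduced transport certificate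
(`…SahiTransportRho.RhoCert`) of the pattern event `allBut c k = Th_{k−c}^k = {at most c of the k coordinates closed}`; hence
(`sahiE_three_nonneg_of_allBut`) `E₃(1_H, 1_U, 1_V) ≥ 0` for every increasing `H` determined by a block with this pattern and all increasing
`U, V`, in every dimension (Kahn's Conjecture 5 / Sahi's `C₃` for that first slot).  Row (o) is weighted LYM (`coeff_lymLevelC_sub_nonneg`), row
(TC) is EXACTLY `Ñ_c ≥ 0` after clearing denominators (`tc_of_Ngen`) — the probabilistic identification of memo g9 §1, now formal for every `c`.
Row (a) is discharged for `c = 2` and every `k` in `…SahiAllButTwoRowA`; for other `(c, k)` it is a finite check (it fails for some large `k`, memo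
g8 §3.1), kept as a hypothesis here.  Nothing is asserted about the crux.
-/

noncomputable section

open scoped Classical

namespace Summit.CriticalPhenomena.PercolationContinuityZ3.Theorems

namespace SahiAllButC

open Finset MvPolynomial
open SahiHittingSlot SahiTransportCert SahiAllButOne SahiAllButTwo SahiCTCForms SahiCTCGenFun
open Literature.Combinatorics.Sahi2008
open Literature.Probability.Percolation (DeterminedBy determinedBy_iff)
open Literature.Probability.Percolation.DecisionTree (ind ind_of_mem ind_of_not_mem ind_nonneg)

variable {k : ℕ} (q : Fin k → unitInterval)

/-! ### The level-`c` pattern events and the certificate -/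

/-- The pattern event `Th_{k−c}^k`: at most `c` coordinates of the block are closed. [this work] -/
def allBut (c k : ℕ) : Set (Set (Fin k)) := {T | #(closed T) ≤ c}

/-- Exactly `c` coordinates closed (the support of the certificate `ρ_c`). [this work] -/
def exC (c k : ℕ) : Set (Set (Fin k)) := {T | #(closed T) = c}

/-- **The certificate** `ρ_c = μ(· | exactly c coordinates closed)`. [this work] -/
def rhoC (c : ℕ) (T : Set (Fin k)) : ℝ := if T ∈ exC c k then bernoulliWeight q T / pr q (exC c k) else 0

/-- `Σ_T ρ_c(T)·1_𝒴(T) = w({=c} ∩ 𝒴)/w({=c})`. [this work] -/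
theorem sum_rhoC_ind (c : ℕ) (𝒴 : Set (Set (Fin k))) : ∑ T, rhoC q c T * ind 𝒴 T = pr q (exC c k ∩ 𝒴) / pr q (exC c k) := by
  rw [pr_inter_eq_sum, sum_div]
  refine sum_congr rfl fun T _ => ?_
  unfold rhoC
  by_cases hT : T ∈ exC c k
  · rw [if_pos hT, ind_of_mem hT]; ring
  · rw [if_neg hT, ind_of_not_mem hT]; ring

/-- `{=c} ⊆ {≤ c}`. [this work] -/
theorem exC_subset (c : ℕ) : exC c k ⊆ allBut c k := fun T (hT : #(closed T) = c) => show #(closed T) ≤ c by omega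

/-- `Th_{k−c}^k` is an up-set. [this work] -/
theorem isUpperSet_allBut (c : ℕ) : IsUpperSet (allBut c k) := by
  intro S T hST hS
  refine le_trans (card_le_card fun i hi => ?_) hS
  rw [closed, mem_filter] at hi ⊢
  exact ⟨hi.1, fun h => hi.2 (hST h)⟩

/-! ### Traces of the level-`c` event as size-filtered families -/

/-- `K_{H ∩ 𝒴} = h(K_𝒴)`. [this work] -/
theorem gf_cx_allBut_inter (c : ℕ) (𝒴 : Set (Set (Fin k))) : gf (cx (allBut c k ∩ 𝒴)) = gf (facesLE c (cx 𝒴)) := by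
  congr 1; ext C
  simp only [mem_cx, facesLE, allBut, Set.mem_inter_iff, Set.mem_setOf_eq, card_closed_compl, mem_filter, mem_powerset, subset_univ, true_and]

/-- `K_{Hᶜ ∩ 𝒴} = t(K_𝒴)`. [this work] -/
theorem gf_cx_compl_inter (c : ℕ) (𝒴 : Set (Set (Fin k))) : gf (cx ((allBut c k)ᶜ ∩ 𝒴)) = gf (facesGT c (cx 𝒴)) := by
  congr 1; ext C
  simp only [mem_cx, facesGT, allBut, Set.mem_inter_iff, Set.mem_compl_iff, Set.mem_setOf_eq, card_closed_compl, mem_filter, mem_powerset,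
    subset_univ, true_and, not_le]

/-- `K_{H ∩ 𝒳 ∩ 𝒵} = h_Y(K_𝒳, K_𝒵)`. [this work] -/
theorem gf_cx_allBut_inter₂ (c : ℕ) (𝒳 𝒵 : Set (Set (Fin k))) : gf (cx (allBut c k ∩ (𝒳 ∩ 𝒵))) = gf (commonLE c (cx 𝒳) (cx 𝒵)) := by
  congr 1; ext C
  simp only [mem_cx, commonLE, allBut, Set.mem_inter_iff, Set.mem_setOf_eq, card_closed_compl, mem_filter, mem_powerset, subset_univ, true_and]

/-- `K_{{=c} ∩ 𝒳 ∩ 𝒵} = e_Y(K_𝒳, K_𝒵)`. [this work] -/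
theorem gf_cx_exC_inter₂ (c : ℕ) (𝒳 𝒵 : Set (Set (Fin k))) : gf (cx (exC c k ∩ (𝒳 ∩ 𝒵))) = gf (commonEQ c (cx 𝒳) (cx 𝒵)) := by
  congr 1; ext C
  simp only [mem_cx, commonEQ, exC, Set.mem_inter_iff, Set.mem_setOf_eq, card_closed_compl, mem_filter, mem_powerset, subset_univ, true_and]

/-- `GF(K_𝒴) = h(K_𝒴) + t(K_𝒴)`. [this work] -/
theorem gf_cx_splitC (c : ℕ) (𝒴 : Set (Set (Fin k))) : gf (cx 𝒴) = gf (facesLE c (cx 𝒴)) + gf (facesGT c (cx 𝒴)) := by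
  rw [← gf_union]
  · congr 1; ext C
    simp only [facesLE, facesGT, mem_union, mem_filter, mem_powerset, subset_univ, true_and]
    constructor
    · intro h; by_cases h2 : #C ≤ c
      · exact Or.inl ⟨h2, h⟩
      · exact Or.inr ⟨by omega, h⟩
    · rintro (⟨_, h⟩ | ⟨_, h⟩) <;> exact h
  · rw [disjoint_left]; intro C h1 h2
    have := (mem_filter.1 h1).2.1; have := (mem_filter.1 h2).2.1; omega

/-- `K_H = Θ_c`. [this work] -/
theorem gf_cx_allBut (c : ℕ) : gf (cx (allBut c k)) = (ThC c : MvPolynomial (Fin k) ℤ) := by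
  unfold ThC bySize; congr 1; ext C
  simp only [mem_cx, allBut, Set.mem_setOf_eq, card_closed_compl, mem_filter, mem_powerset, subset_univ, true_and]

/-- `K_{Hᶜ} = D_c`. [this work] -/
theorem gf_cx_allBut_compl (c : ℕ) : gf (cx (allBut c k)ᶜ) = (DdC c : MvPolynomial (Fin k) ℤ) := by
  unfold DdC bySize; congr 1; ext C
  simp only [mem_cx, allBut, Set.mem_compl_iff, Set.mem_setOf_eq, card_closed_compl, mem_filter, mem_powerset, subset_univ, true_and, not_le]

/-- `K_{=c} = e_c`. [this work] -/
theorem gf_cx_exC (c : ℕ) : gf (cx (exC c k)) = (ee c : MvPolynomial (Fin k) ℤ) := by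
  unfold ee bySize; congr 1; ext C
  simp only [mem_cx, exC, Set.mem_setOf_eq, card_closed_compl, mem_filter, mem_powerset, subset_univ, true_and]

/-- `Π = Θ_c + D_c`. [this work] -/
theorem PiP_eq_ThC_add_DdC (c : ℕ) : (PiP : MvPolynomial (Fin k) ℤ) = ThC c + DdC c := by
  unfold PiP ThC DdC bySize
  rw [← gf_union]
  · congr 1; ext C
    simp only [mem_union, mem_filter, mem_powerset, subset_univ, true_and, true_iff]; omega
  · rw [disjoint_left]; intro C h1 h2
    have := (mem_filter.1 h1).2; have := (mem_filter.1 h2).2; omega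

/-! ### Row (o): the LYM inequality `e_c·t_K ≤ D_c·K_{=c}` -/

/-- `K_{=c}`: the common level-`c` faces of `K` with itself. [this work] -/
theorem commonEQ_self (c : ℕ) (K : Finset (Finset (Fin k))) : commonEQ c K K = univ.powerset.filter fun S => #S = c ∧ S ∈ K := by
  ext S; simp only [commonEQ, mem_filter, and_self]

/-- **Weighted LYM for the (o) row**: for a down-set `K`, `D_c·K_{=c} − e_c·t_K ∈ ℕ[r]`. [this work] -/
theorem coeff_lymLevelC_sub_nonneg (c : ℕ) {K : Finset (Finset (Fin k))} (hK : IsLowerSet (K : Set (Finset (Fin k)))) (n : Fin k →₀ ℕ) :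
    0 ≤ (DdC c * gf (commonEQ c K K) - ee c * gf (facesGT c K) : MvPolynomial (Fin k) ℤ).coeff n := by
  have hKV : ∀ S ∈ K, S ⊆ (univ : Finset (Fin k)) := fun S _ => subset_univ S
  have hVV : ∀ S ∈ (univ : Finset (Fin k)).powerset, S ⊆ (univ : Finset (Fin k)) := fun S _ => subset_univ S
  set R := range (#(univ : Finset (Fin k)) + 1) with hR
  have e1 : (DdC c : MvPolynomial (Fin k) ℤ) = ∑ j ∈ R.filter (fun j => c < j), gf (univ.powerset.filter fun P : Finset (Fin k) => #P = j) := by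
    unfold DdC bySize; exact gf_filter_card_eq_sum hVV (fun j => c < j)
  have e2 : gf (commonEQ c K K) = gf (K.filter fun S => #S = c) := by
    rw [commonEQ_self]; congr 1; ext S; simp only [mem_filter, mem_powerset, subset_univ, true_and]; tauto
  have e3 : (ee c : MvPolynomial (Fin k) ℤ) = gf (univ.powerset.filter fun P : Finset (Fin k) => #P = c) := rfl
  have e4 : gf (facesGT c K) = ∑ j ∈ R.filter (fun j => c < j), gf (K.filter fun S => #S = j) := by
    rw [facesGT_eq_filter]; exact gf_filter_card_eq_sum hKV (fun j => c < j)
  rw [e1, e2, e3, e4, sum_mul, mul_sum, ← sum_sub_distrib, coeff_sum]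
  refine sum_nonneg fun j hj => ?_
  have hj2 := (mem_filter.1 hj).2
  exact coeff_downLYM_sub_nonneg hK (show c ≤ j by omega) n

/-! ### The rows in real terms -/

section Interior

variable {q} (hq : ∀ i, 0 < (q i : ℝ) ∧ (q i : ℝ) < 1)
include hq

omit hq in
/-- `ev` of `Ñ_c`, expanded. [this work] -/
theorem ev_Ngen (c : ℕ) (KX KZ : Finset (Finset (Fin k))) : ev q (Ngen c KX KZ) =
    ev q (ee c) * (ev q PiP + ev q (DdC c)) * (ev q PiP * ev q (gf (commonLE c KX KZ)) - ev q (gf (facesLE c KX)) * ev q (gf (facesLE c KZ)))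
      - ev q (ThC c) * ev q PiP * ev q (DdC c) * ev q (gf (commonEQ c KX KZ))
      - ev q (ee c) * ev q (DdC c) * (ev q (gf (facesLE c KX)) * ev q (gf (facesGT c KZ)) + ev q (gf (facesGT c KX)) * ev q (gf (facesLE c KZ)))
      + ev q (ee c) * ev q (ThC c) * ev q (gf (facesGT c KX)) * ev q (gf (facesGT c KZ)) := by
  unfold ev Ngen
  simp only [eval₂_add, eval₂_sub, eval₂_mul]

omit hq in
/-- `Π = Θ_c + D_c` at `r`. [this work] -/
theorem ev_PiP_eqC (c : ℕ) : ev q (PiP : MvPolynomial (Fin k) ℤ) = ev q (ThC c) + ev q (DdC c) := by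
  unfold ev; rw [PiP_eq_ThC_add_DdC c, eval₂_add]

/-- `e_c(r) > 0` when the block has at least `c` coordinates. [this work] -/
theorem ev_ee_pos {c : ℕ} (hck : c ≤ k) : 0 < ev q (ee c : MvPolynomial (Fin k) ℤ) := by
  unfold ee
  rw [ev_gf]
  obtain ⟨C, hC⟩ : (powersetCard c (univ : Finset (Fin k))).Nonempty := powersetCard_nonempty.2 (by rw [card_univ, Fintype.card_fin]; exact hck)
  have hCmem : C ∈ (bySize (· = c) : Finset (Finset (Fin k))) :=
    mem_filter.2 ⟨mem_powerset.2 (subset_univ _), (mem_powersetCard.1 hC).2⟩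
  refine lt_of_lt_of_le ?_ (single_le_sum (f := fun C : Finset (Fin k) => ∏ i ∈ C, r q i) (fun C _ => prod_nonneg fun i _ => r_nonneg hq i) hCmem)
  exact prod_pos fun i _ => r_pos hq i

/-- **(TC) from `Ñ_c ≥ 0`** at a pair of nonempty up-sets. [this work] -/
theorem tc_of_Ngen {c : ℕ} (hck : c ≤ k) {𝒳 𝒵 : Set (Set (Fin k))} (hN : 0 ≤ ev q (Ngen c (cx 𝒳) (cx 𝒵))) :
    pr q (allBut c k) * (1 - pr q (allBut c k)) * ∑ T, rhoC q c T * ind (𝒳 ∩ 𝒵) T ≤ tcRHS q (allBut c k) 𝒳 𝒵 := by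
  have hW := W_pos hq
  have hec := ev_ee_pos hq hck
  have hr0 : ∀ i, 0 ≤ r q i := r_nonneg hq
  -- the dictionary
  have hθ : pr q (allBut c k) = W q * ev q (ThC c) := by rw [pr_eq_ev hq, gf_cx_allBut]
  have hδ : 1 - pr q (allBut c k) = W q * ev q (DdC c) := by rw [← pr_compl, pr_eq_ev hq, gf_cx_allBut_compl]
  have hπ : pr q (exC c k) = W q * ev q (ee c) := by rw [pr_eq_ev hq, gf_cx_exC]
  have hPi := W_mul_ev_PiP hq
  have hPi' := ev_PiP_eqC (q := q) c
  have hY : pr q (exC c k ∩ (𝒳 ∩ 𝒵)) = W q * ev q (gf (commonEQ c (cx 𝒳) (cx 𝒵))) := by rw [pr_eq_ev hq, gf_cx_exC_inter₂]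
  have hHY : pr q (allBut c k ∩ (𝒳 ∩ 𝒵)) = W q * ev q (gf (commonLE c (cx 𝒳) (cx 𝒵))) := by rw [pr_eq_ev hq, gf_cx_allBut_inter₂]
  have hX : pr q 𝒳 = W q * (ev q (gf (facesLE c (cx 𝒳))) + ev q (gf (facesGT c (cx 𝒳)))) := by
    rw [pr_eq_ev hq, gf_cx_splitC c]; unfold ev; rw [eval₂_add]
  have hZ : pr q 𝒵 = W q * (ev q (gf (facesLE c (cx 𝒵))) + ev q (gf (facesGT c (cx 𝒵)))) := by
    rw [pr_eq_ev hq, gf_cx_splitC c]; unfold ev; rw [eval₂_add]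
  have htX : pr q ((allBut c k)ᶜ ∩ 𝒳) = W q * ev q (gf (facesGT c (cx 𝒳))) := by rw [pr_eq_ev hq, gf_cx_compl_inter]
  have htZ : pr q ((allBut c k)ᶜ ∩ 𝒵) = W q * ev q (gf (facesGT c (cx 𝒵))) := by rw [pr_eq_ev hq, gf_cx_compl_inter]
  have hin : pr q (𝒳 ∩ 𝒵) - pr q ((allBut c k)ᶜ ∩ (𝒳 ∩ 𝒵)) = W q * ev q (gf (commonLE c (cx 𝒳) (cx 𝒵))) := by
    rw [pr_compl_inter, ← hHY]; ring
  rw [sum_rhoC_ind, tcRHS, show (2 - pr q (allBut c k)) * (pr q (𝒳 ∩ 𝒵) - pr q 𝒳 * pr q 𝒵 - pr q ((allBut c k)ᶜ ∩ (𝒳 ∩ 𝒵))) =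
    (2 - pr q (allBut c k)) * ((pr q (𝒳 ∩ 𝒵) - pr q ((allBut c k)ᶜ ∩ (𝒳 ∩ 𝒵))) - pr q 𝒳 * pr q 𝒵) by ring, hin,
    show (2 : ℝ) - pr q (allBut c k) = 1 + (1 - pr q (allBut c k)) by ring, hδ, hθ, hπ, hY, hX, hZ, htX, htZ]
  rw [ev_Ngen] at hN
  -- abbreviate the real numbers
  set W' := W q
  set Pv := ev q (PiP : MvPolynomial (Fin k) ℤ)
  set Θv := ev q (ThC c : MvPolynomial (Fin k) ℤ)
  set Dv := ev q (DdC c : MvPolynomial (Fin k) ℤ)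
  set e2 := ev q (ee c : MvPolynomial (Fin k) ℤ)
  set hXv := ev q (gf (facesLE c (cx 𝒳)))
  set tXv := ev q (gf (facesGT c (cx 𝒳)))
  set hZv := ev q (gf (facesLE c (cx 𝒵)))
  set tZv := ev q (gf (facesGT c (cx 𝒵)))
  set hYv := ev q (gf (commonLE c (cx 𝒳) (cx 𝒵)))
  set eYv := ev q (gf (commonEQ c (cx 𝒳) (cx 𝒵)))
  have hPpos : 0 < Pv := pos_of_mul_pos_right (by rw [hPi]; exact one_pos) hW.le
  have hWP : W' = 1 / Pv := by
    field_simp; linarith [hPi]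
  rw [div_eq_mul_inv, hWP]
  rw [hPi'] at hN hPpos ⊢
  have hΘD : 0 < Θv + Dv := hPpos
  rw [← sub_nonneg]
  have key : (1 + 1 / (Θv + Dv) * Dv) * (1 / (Θv + Dv) * hYv - 1 / (Θv + Dv) * (hXv + tXv) * (1 / (Θv + Dv) * (hZv + tZv))) +
      1 / (Θv + Dv) * (hXv + tXv) * (1 / (Θv + Dv) * tZv) + 1 / (Θv + Dv) * (hZv + tZv) * (1 / (Θv + Dv) * tXv) -
      1 / (Θv + Dv) * Θv * (1 / (Θv + Dv) * Dv) * (1 / (Θv + Dv) * eYv * (1 / (Θv + Dv) * e2)⁻¹) =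
      (e2 * ((Θv + Dv) + Dv) * ((Θv + Dv) * hYv - hXv * hZv) - Θv * (Θv + Dv) * Dv * eYv
        - e2 * Dv * (hXv * tZv + tXv * hZv) + e2 * Θv * tXv * tZv) / (e2 * (Θv + Dv) ^ 3) := by
    field_simp
    ring
  rw [key]
  exact div_nonneg hN (by positivity)

/-- **(o) from weighted LYM** at an up-set. [this work] -/
theorem o_rowC {c : ℕ} (hck : c ≤ k) {𝒯 : Set (Set (Fin k))} (h𝒯 : IsUpperSet 𝒯) :
    pr q ((allBut c k)ᶜ ∩ 𝒯) ≤ (1 - pr q (allBut c k)) * ∑ T, rhoC q c T * ind 𝒯 T := by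
  have hW := W_pos hq
  have hec := ev_ee_pos hq hck
  have hr0 : ∀ i, 0 ≤ r q i := r_nonneg hq
  have hδ : 1 - pr q (allBut c k) = W q * ev q (DdC c) := by rw [← pr_compl, pr_eq_ev hq, gf_cx_allBut_compl]
  have hπ : pr q (exC c k) = W q * ev q (ee c) := by rw [pr_eq_ev hq, gf_cx_exC]
  have hE : pr q (exC c k ∩ 𝒯) = W q * ev q (gf (commonEQ c (cx 𝒯) (cx 𝒯))) := by
    rw [pr_eq_ev hq, ← gf_cx_exC_inter₂, Set.inter_self]
  have ht : pr q ((allBut c k)ᶜ ∩ 𝒯) = W q * ev q (gf (facesGT c (cx 𝒯))) := by rw [pr_eq_ev hq, gf_cx_compl_inter]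
  have hlym : ev q (ee c * gf (facesGT c (cx 𝒯))) ≤ ev q (DdC c * gf (commonEQ c (cx 𝒯) (cx 𝒯))) := by
    have h := eval_le_of_coeff_le (P := (0 : MvPolynomial (Fin k) ℤ)) (Q := DdC c * gf (commonEQ c (cx 𝒯) (cx 𝒯)) - ee c * gf (facesGT c (cx 𝒯)))
      (fun m => by rw [coeff_zero]; exact coeff_lymLevelC_sub_nonneg c (isLowerSet_cx h𝒯) m) (r q) hr0
    rw [eval₂_zero, eval₂_sub, sub_nonneg] at h
    exact h
  unfold ev at hlym
  rw [eval₂_mul, eval₂_mul] at hlym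
  rw [sum_rhoC_ind, ht, hδ, hπ, hE, mul_div_mul_left _ _ hW.ne']
  rw [show W q * ev q (DdC c) * (ev q (gf (commonEQ c (cx 𝒯) (cx 𝒯))) / ev q (ee c)) =
    W q * (ev q (DdC c) * ev q (gf (commonEQ c (cx 𝒯) (cx 𝒯))) / ev q (ee c)) by ring]
  refine mul_le_mul_of_nonneg_left ?_ hW.le
  rw [le_div_iff₀ hec]
  unfold ev
  linarith [hlym]

/-- **THE LEVEL-`c` THRESHOLD CERTIFICATE (conditional form).**  For `c ≤ k` and interior parameters, if the capacity inequality (a)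
`Θ_c(r)D_c(r) ≤ (Π(r)+D_c(r))e_c(r)` holds and `Ñ_c(K_𝒳,K_𝒵)(r) ≥ 0` for all nonempty up-sets `𝒳, 𝒵`, then `ρ_c` is a reduced transport
certificate of `allBut c k`. [this work] -/
theorem rhoCert_allBut {c : ℕ} (hck : c ≤ k) (hA : ev q (ThC c) * ev q (DdC c) ≤ (ev q PiP + ev q (DdC c)) * ev q (ee c : MvPolynomial (Fin k) ℤ))
    (hN : ∀ 𝒳 𝒵 : Set (Set (Fin k)), IsUpperSet 𝒳 → IsUpperSet 𝒵 → 𝒳.Nonempty → 𝒵.Nonempty → 0 ≤ ev q (Ngen c (cx 𝒳) (cx 𝒵))) :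
    RhoCert q (allBut c k) (rhoC q c) := by
  have hW := W_pos hq
  have hec := ev_ee_pos hq hck
  have hθ : pr q (allBut c k) = W q * ev q (ThC c) := by rw [pr_eq_ev hq, gf_cx_allBut]
  have hδ : 1 - pr q (allBut c k) = W q * ev q (DdC c) := by rw [← pr_compl, pr_eq_ev hq, gf_cx_allBut_compl]
  have hπ : pr q (exC c k) = W q * ev q (ee c) := by rw [pr_eq_ev hq, gf_cx_exC]
  have hPi := W_mul_ev_PiP hq
  have hπpos : 0 < pr q (exC c k) := by rw [hπ]; exact mul_pos hW hec
  have hθ1 : pr q (allBut c k) ≤ 1 := pr_le_one q _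
  refine ⟨fun T => ?_, fun T hT => ?_, ?_, fun T => ?_, fun 𝒯 h𝒯 => o_rowC hq hck h𝒯, fun 𝒳 𝒵 h𝒳 h𝒵 => ?_⟩
  · -- `ρ ≥ 0`
    unfold rhoC; split_ifs
    · exact div_nonneg (bw_nonneg q T) hπpos.le
    · exact le_rfl
  · -- support
    unfold rhoC; rw [if_neg fun h => hT (exC_subset c h)]
  · -- mass one
    have h := sum_rhoC_ind q c (Set.univ : Set (Set (Fin k)))
    simp only [Set.inter_univ] at h
    rw [div_self hπpos.ne'] at h
    rw [← h]
    exact sum_congr rfl fun T _ => by rw [ind_of_mem (Set.mem_univ T), mul_one]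
  · -- (a) capacity
    unfold rhoC
    split_ifs with hT
    · rw [mul_div_assoc']
      rw [div_le_iff₀ hπpos]
      have hb := bw_nonneg q T
      have key : pr q (allBut c k) * (1 - pr q (allBut c k)) ≤ (2 - pr q (allBut c k)) * pr q (exC c k) := by
        rw [show (2 : ℝ) - pr q (allBut c k) = 1 + (1 - pr q (allBut c k)) by ring, hδ, hθ, hπ, ← hPi]
        have : W q * ev q (ThC c) * (W q * ev q (DdC c)) = W q * W q * (ev q (ThC c) * ev q (DdC c)) := by ring
        rw [this, show (W q * ev q PiP + W q * ev q (DdC c)) * (W q * ev q (ee c)) = W q * W q * ((ev q PiP + ev q (DdC c)) * ev q (ee c)) by ring]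
        exact mul_le_mul_of_nonneg_left hA (mul_nonneg hW.le hW.le)
      nlinarith [key, hb]
    · rw [mul_zero]; exact mul_nonneg (by linarith) (bw_nonneg q T)
  · -- (TC)
    by_cases hne : 𝒳.Nonempty ∧ 𝒵.Nonempty
    · exact tc_of_Ngen hq hck (hN 𝒳 𝒵 h𝒳 h𝒵 hne.1 hne.2)
    · have h0 : 𝒳 ∩ 𝒵 = ∅ := by
        rw [not_and_or, Set.not_nonempty_iff_eq_empty, Set.not_nonempty_iff_eq_empty] at hne
        rcases hne with h | h
        · rw [h, Set.empty_inter]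
        · rw [h, Set.inter_empty]
      have hL : ∑ T, rhoC q c T * ind (𝒳 ∩ 𝒵) T = 0 := sum_eq_zero fun T _ => by rw [h0, ind_of_not_mem (Set.notMem_empty T), mul_zero]
      rw [hL, mul_zero, tcRHS, h0, Set.inter_empty, SahiTransportCert.pr_empty]
      rw [not_and_or, Set.not_nonempty_iff_eq_empty, Set.not_nonempty_iff_eq_empty] at hne
      rcases hne with h | h
      · rw [h, SahiTransportCert.pr_empty, Set.inter_empty, SahiTransportCert.pr_empty]; ring_nf; rfl
      · rw [h, SahiTransportCert.pr_empty, Set.inter_empty, SahiTransportCert.pr_empty]; ring_nf; rfl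

end Interior

/-- **KAHN'S CONJECTURE 5 / SAHI'S `C₃` FOR THE LEVEL-`c` THRESHOLD FIRST SLOT, CONDITIONAL ON (a) AND THE CERTIFICATE POLYNOMIAL `Ñ_c`.**  For a
block `e : Fin k ↪ ι` (`c ≤ k`) with interior parameters, an increasing event `H` determined by the block whose pattern event is `allBut c k`
(at most `c` of the `k` coordinates closed), the two hypotheses of `rhoCert_allBut` at the block odds, and ALL increasing `U, V`:
`E₃(1_H, 1_U, 1_V) ≥ 0`. [this work] -/
theorem sahiE_three_nonneg_of_allBut {ι : Type} [Fintype ι] (p : ι → unitInterval) (e : Fin k ↪ ι) {c : ℕ} (hck : c ≤ k)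
    (hp : ∀ i, 0 < (p (e i) : ℝ) ∧ (p (e i) : ℝ) < 1)
    (hA : ev (pk e p) (ThC c) * ev (pk e p) (DdC c) ≤ (ev (pk e p) PiP + ev (pk e p) (DdC c)) * ev (pk e p) (ee c : MvPolynomial (Fin k) ℤ))
    (hN : ∀ 𝒳 𝒵 : Set (Set (Fin k)), IsUpperSet 𝒳 → IsUpperSet 𝒵 → 𝒳.Nonempty → 𝒵.Nonempty → 0 ≤ ev (pk e p) (Ngen c (cx 𝒳) (cx 𝒵)))
    {H : Set (Set ι)} (hH : DeterminedBy H (Set.range e)) (hpat : pat e H = allBut c k) {U V : Set (Set ι)} (hU : IsUpperSet U) (hV : IsUpperSet V) :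
    0 ≤ sahiE (bernoulliWeight p) 3 ![ind H, ind U, ind V] := by
  have hq : ∀ i, 0 < (pk e p i : ℝ) ∧ (pk e p i : ℝ) < 1 := hp
  have hc : RhoCert (pk e p) (pat e H) (rhoC (pk e p) c) := by rw [hpat]; exact rhoCert_allBut hq hck hA hN
  exact sahiE_three_nonneg_of_rhoCert p e hH hc hU hV

end SahiAllButC

end Summit.CriticalPhenomena.PercolationContinuityZ3.Theorems
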